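import Summits.CriticalPhenomena.PercolationContinuityZ3.Theorems.PercNearOneGluingNoHeavyLowerTailSunflowerWindowKit
import Summits.CriticalPhenomena.PercolationContinuityZ3.Theorems.PercNearOneGluingNoHeavyLowerTailSunflowerRestrictionTwoPetal
import HarnessLib

/-!
# `NoHeavyLowerTail` (crux stmt-CriticalPhenomena-4575), abstract sunflower cubic: graph-mark sunflowers — two small tools for the NON-PROPER programme:
# the four-point label calculus `IsGraphMarkOn.lab_insert₄` (hypothesis normal form of 4-point structured windows, generator gen26/v2/gen_wink.py:
# `theta (Iab ∪ Iac ∪ Iad ∪ Ibc ∪ Ibd ∪ Icd ∪ (nb a ∪ nb b ∪ nb c ∪ nb d))`) and the PETAL-FREE TERMINAL CASE `Sunflower.ZP_nonneg_of_petal_free`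
# (★ on every sub-cube none of whose subsets carries the petal label `k`, from the tree's `ZP_le_ZP_insert_of_petal_free`; for graph-mark sunflowers:
# every sub-cube spanning at most two colours).

Support file (seat `prim-ineq-gen-2` gen 26; `--supports stmt-CriticalPhenomena-4575`).  No `sorry`; nothing is asserted about the crux.
Memo: run/shared/lean/prim/prim-ineq-gen-2/GRAPHMARK-LEAN-GEN26.md §7.
-/

namespace Summit.CriticalPhenomena.PercolationContinuityZ3.Theorems.SunflowerPartition

open Finset

variable {α : Type*} [DecidableEq α]
variable {c : α → α → Option (Fin 3)} {T : α → Finset (Fin 3)} {F : Sunflower α} {W : Finset α}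

/-- Four-point label calculus: adding four unmarked points. [this work] -/
theorem Sunflower.IsGraphMarkOn.lab_insert₄ (h : F.IsGraphMarkOn c T W) (hsym : ∀ x y, c x y = c y x) (hirr : ∀ x, c x x = none)
    {a b d e : α} (ha : a ∈ W) (hb : b ∈ W) (hd : d ∈ W) (he : e ∈ W) (hTa : T a = ∅) (hTb : T b = ∅) (hTd : T d = ∅) (hTe : T e = ∅)
    {X : Finset α} (hX : X ⊆ W) :
    F.lab (insert a (insert b (insert d (insert e X)))) =
      joinM (F.lab X) (theta ((c a b).toFinset ∪ (c a d).toFinset ∪ (c a e).toFinset ∪ (c b d).toFinset ∪ (c b e).toFinset ∪ (c d e).toFinset ∪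
        (nb c a X ∪ nb c b X ∪ nb c d X ∪ nb c e X))) := by
  rw [h.lab_insert hsym hirr ha hTa (insert_subset hb (insert_subset hd (insert_subset he hX))), nb_insert, nb_insert, nb_insert,
    h.lab_insert₃ hsym hirr hb hd he hTb hTd hTe hX, joinM_joinM, ← theta_union]
  congr 2
  ext i; simp only [mem_union]; tauto

/-- ★ on every PETAL-FREE sub-cube: if the petal value `k` is not the label of any subset of `W`, then `0 ≤ F.ZP W ∅ ∅ ∅` (induction on `W` with the tree's
`ZP_le_ZP_insert_of_petal_free`).  For graph-mark sunflowers: a sub-cube spanning at most two colours (edges inside `W` ∪ marks in `W`) is a terminal case of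
any induction. [this work] -/
theorem Sunflower.ZP_nonneg_of_petal_free [Fintype α] (F : Sunflower α) (k : Fin 5) (hk : k = 1 ∨ k = 2 ∨ k = 3) (W : Finset α)
    (hfree : ∀ S, S ⊆ W → F.lab S ≠ k) : 0 ≤ F.ZP W ∅ ∅ ∅ := by
  induction W using Finset.induction_on with
  | empty => rw [F.ZP_empty]
  | insert e W' he ih =>
    exact le_trans (ih fun S hS => hfree S (hS.trans (subset_insert e W')))
      (F.ZP_le_ZP_insert_of_petal_free W' e he k hk hfree)

end Summit.CriticalPhenomena.PercolationContinuityZ3.Theorems.SunflowerPartition
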